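import Summits.RiemannHypothesis.RiemannHypothesis.Theorems.WeilFormatCTailJPrelim
import Summits.RiemannHypothesis.RiemannHypothesis.Theorems.WeilFormatCTailMajorant
import Summits.RiemannHypothesis.RiemannHypothesis.Theorems.WeilFormatCSoundness
import HarnessLib

/-!
# Format C, L-C3b at every order (odd sector): the order-`J` TAIL majorant — polar merged, Hankel form

Route context: Fourier–Galerkin / Schur-complement certificates of Weil positivity on a window ("format C";
cell memo `run/shared/lean/pub/rh-explicit/rh-explicit-weil-10/FORMATC-DESIGN.md` §9.9; supporting
stmt-RiemannHypothesis-0098; seat rh-explicit-weil-10).  Odd twin of `WeilFormatCTailEvenJ`: for the odd SectorSplit kernel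
`M⁻(k,l) = (G(k+1,l+1) − G(k+1,−(l+1)))/2` of `gramCoeff a` (row mode `i = k+1`, tail mode `m = l+1 ≥ B₃+1 > 2B`), by
`WeilFormatC.abs_oddKernel_col_sub_sum_le` and the expansion of the odd polar factor `d_m = ω_m/(1+4ω_m²)`
(`WeilFormatC.abs_oddPolarFactor_sub_sum_le`):

`M⁻(i,m) = (−1)^m [ (F_m/π)·Σ_{j<J} v^A_j(i)/m^{2j+2} + Σ_{r<J} v^B_r(i)/m^{2r+1} ] + r_m(i)`, `|r_m(i)| ≤ ρ_i/m^{2J+1}`,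

with `v^A_j(i) = (−1)^i i^{2j+1}`, `v^B_r(i) = (−1)^i(−i^{2r}F_i/π − (4s²/π)(−1)^r q^r d_i)`,
`ρ_i = 2C_F i^{2J}/π + (4s²/π) q^J d_i`.  Then Peter–Paul (`θ`, `η`), weights `1/d_l ≤ 1/d₀`, and the Hankel bounds of
`WeilFormatC.sum_Ico_sq_sum_div_pow_le` on the shifted range `m ∈ [B₃+1, N+1)` (`hi(e) = 1/((e−1)B₃^{e−1})`,
`lo(e) = 1/((e−1)(B₃+1)^{e−1})`, `λ = B^{e}`):

* `abs_oddKernel_col_sub_families_le` — the decomposition with remainder;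
* `odd_tailJ_majorant` — `Σ_{l∈Ico B₃ N} (Σ_k M⁻(k,l)x_k)²/d_l ≤ (1+θ)(1+η)(C_A²/(π²d₀))·Q_A + (1+θ)(1+η⁻¹)(1/d₀)·Q_B
  + (1+θ⁻¹)·B·(Σ_kρ_k²x_k²)/(d₀(4J+1)B₃^{4J+1})`, `C_A = π/4 + ΛΣ + a(1+E)/(π(B₃+1))`.

Replaces the order-1 `WeilFormatC.odd_tail_majorant`.  Standard axioms; no definitions; no RH claim.
-/

set_option autoImplicit false
-- `Summit.RiemannHypothesis.RiemannHypothesis.…` is the layout-mandated namespace (summit = problem name).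
set_option linter.dupNamespace false

noncomputable section

open Complex Finset Matrix
open scoped Real BigOperators ArithmeticFunction.vonMangoldt

namespace Summit.RiemannHypothesis.RiemannHypothesis.Theorems.WeilFormatC

open Literature.NumberTheory.LFunctions Literature.NumberTheory.LFunctions.Yoshida1992
open Literature.Analysis.SpecialFunctions

variable {a : ℝ}

/-! ## The odd column decomposition at order `J` -/

section Decomp

/-- **Odd column decomposition, order `J`.**  For `a > 0`, `1 ≤ i`, `2i ≤ m` (modes):
`|M⁻(i,m) − (−1)^m[(F_m/π)Σ_{j<J}(−1)^i i^{2j+1}/m^{2j+2} + Σ_{r<J}(−1)^i(−i^{2r}F_i/π − (4s²/π)(−1)^r q^r d_i)/m^{2r+1}]|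
 ≤ (2C_F i^{2J}/π + (4s²/π)q^J d_i)/m^{2J+1}`. -/
theorem abs_oddKernel_col_sub_families_le (ha : 0 < a) {i m : ℕ} (hi : 1 ≤ i) (him : 2 * i ≤ m) (J : ℕ) :
    |(gramCoeff a i m - gramCoeff a i (-(m : ℤ))) / 2
      - (-1 : ℝ) ^ m *
        (((Complex.digamma (1 / 4 + ((freq a m : ℝ) : ℂ) / 2 * I)).im / 2 + (∑ k ∈ weilPrimeIndex a, (Λ k : ℝ) / Real.sqrt k * Real.sin (freq a m * Real.log k)) - archExpSumSin a m) / π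
            * ∑ j ∈ Finset.range J, ((-1 : ℝ) ^ i * (i : ℝ) ^ (2 * j + 1)) / (m : ℝ) ^ (2 * j + 2)
          + ∑ r ∈ Finset.range J, ((-1 : ℝ) ^ i *
              (-((i : ℝ) ^ (2 * r)) * ((Complex.digamma (1 / 4 + ((freq a i : ℝ) : ℂ) / 2 * I)).im / 2 + (∑ k ∈ weilPrimeIndex a, (Λ k : ℝ) / Real.sqrt k * Real.sin (freq a i * Real.log k)) - archExpSumSin a i) / π
                - 4 * (Real.exp (a / 2) - Real.exp (-(a / 2))) ^ 2 / π * (-1 : ℝ) ^ r * (a ^ 2 / (4 * π ^ 2)) ^ r * (freq a i / (1 + 4 * freq a i ^ 2)))) / (m : ℝ) ^ (2 * r + 1))|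
      ≤ (2 * (π / 4 + (∑ k ∈ weilPrimeIndex a, (Λ k : ℝ) / Real.sqrt k) + a * (1 + weilArchDensity (2 * a)) / π) * (i : ℝ) ^ (2 * J) / π
          + 4 * (Real.exp (a / 2) - Real.exp (-(a / 2))) ^ 2 / π * (a ^ 2 / (4 * π ^ 2)) ^ J * (freq a i / (1 + 4 * freq a i ^ 2))) / (m : ℝ) ^ (2 * J + 1) := by
  have hm : 1 ≤ m := by omega
  have him' : i < m := by omega
  have hm0 : (0 : ℝ) < m := by exact_mod_cast hm
  have hK := abs_oddKernel_col_sub_sum_le ha hi him J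
  have hP := abs_oddPolarFactor_sub_sum_le ha hm J
  -- names
  generalize (gramCoeff a i m - gramCoeff a i (-(m : ℤ))) / 2 = Mim at hK ⊢
  generalize (Complex.digamma (1 / 4 + ((freq a m : ℝ) : ℂ) / 2 * I)).im / 2
      + (∑ k ∈ weilPrimeIndex a, (Λ k : ℝ) / Real.sqrt k * Real.sin (freq a m * Real.log k)) - archExpSumSin a m = Fm
    at hK ⊢
  generalize (Complex.digamma (1 / 4 + ((freq a i : ℝ) : ℂ) / 2 * I)).im / 2
      + (∑ k ∈ weilPrimeIndex a, (Λ k : ℝ) / Real.sqrt k * Real.sin (freq a i * Real.log k)) - archExpSumSin a i = Fi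
    at hK ⊢
  generalize (π / 4 + (∑ k ∈ weilPrimeIndex a, (Λ k : ℝ) / Real.sqrt k) + a * (1 + weilArchDensity (2 * a)) / π) = CF
    at hK ⊢
  have hdi : 0 < freq a i / (1 + 4 * freq a i ^ 2) := by
    have := freq_pos ha hi
    positivity
  have hkS : 0 < (Real.exp (a / 2) - Real.exp (-(a / 2))) ^ 2 := by
    have h1 : Real.exp (-(a / 2)) < Real.exp (a / 2) := Real.exp_lt_exp.mpr (by linarith)
    apply pow_pos; linarith
  have hq : 0 < a ^ 2 / (4 * π ^ 2) := by positivity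
  generalize freq a i / (1 + 4 * freq a i ^ 2) = di at hK hdi ⊢
  generalize hdm : freq a m / (1 + 4 * freq a m ^ 2) = dm at hK hP
  generalize (Real.exp (a / 2) - Real.exp (-(a / 2))) ^ 2 = S2 at hK hkS ⊢
  generalize a ^ 2 / (4 * π ^ 2) = q at hP hq ⊢
  set S := ∑ r ∈ Finset.range J, (-1 : ℝ) ^ r * (a / (4 * π)) * q ^ r / (m : ℝ) ^ (2 * r + 1) with hS
  have hsign : (-1 : ℝ) ^ ((i : ℤ) + m) = (-1) ^ i * (-1) ^ m := by
    rw [zpow_add₀ (by norm_num : (-1 : ℝ) ≠ 0), zpow_natCast, zpow_natCast]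
  set SA := ∑ j ∈ Finset.range J, (i : ℝ) ^ (2 * j + 1) / (m : ℝ) ^ (2 * j + 2) with hSA
  set SB := ∑ j ∈ Finset.range J, Fi * (i : ℝ) ^ (2 * j) / (π * (m : ℝ) ^ (2 * j + 1)) with hSB
  have h4 : ∑ j ∈ Finset.range J, (-1 : ℝ) ^ i * (i : ℝ) ^ (2 * j + 1) / (m : ℝ) ^ (2 * j + 2) = (-1 : ℝ) ^ i * SA := by
    rw [hSA, Finset.mul_sum]
    refine Finset.sum_congr rfl fun j _ ↦ by ring
  have h3 : ∑ r ∈ Finset.range J, ((-1 : ℝ) ^ i *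
          (-((i : ℝ) ^ (2 * r)) * Fi / π - 4 * S2 / π * (-1 : ℝ) ^ r * q ^ r * di)) / (m : ℝ) ^ (2 * r + 1)
        = (-1 : ℝ) ^ i * (-SB - 16 / a * S2 * di * S) := by
    have ha0 : a ≠ 0 := ha.ne'
    conv_rhs => rw [hSB, hS, Finset.mul_sum, ← Finset.sum_neg_distrib, ← Finset.sum_sub_distrib, Finset.mul_sum]
    refine Finset.sum_congr rfl fun r _ ↦ ?_
    field_simp
    ring
  have h5 : ∑ j ∈ Finset.range J, (Fm * (i : ℝ) ^ (2 * j + 1) / (π * (m : ℝ) ^ (2 * j + 2))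
          - Fi * (i : ℝ) ^ (2 * j) / (π * (m : ℝ) ^ (2 * j + 1)))
      = Fm / π * SA - SB := by
    rw [Finset.sum_sub_distrib, hSA, hSB, Finset.mul_sum]
    congr 1
    refine Finset.sum_congr rfl fun j _ ↦ ?_
    field_simp
  have e : Mim - (-1 : ℝ) ^ m *
        (Fm / π * ∑ j ∈ Finset.range J, ((-1 : ℝ) ^ i * (i : ℝ) ^ (2 * j + 1)) / (m : ℝ) ^ (2 * j + 2)
          + ∑ r ∈ Finset.range J, ((-1 : ℝ) ^ i *
              (-((i : ℝ) ^ (2 * r)) * Fi / π - 4 * S2 / π * (-1 : ℝ) ^ r * q ^ r * di)) / (m : ℝ) ^ (2 * r + 1))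
      = (Mim - (-1 : ℝ) ^ ((i : ℤ) + m) *
          (-(16 / a * S2) * di * dm + ∑ j ∈ Finset.range J, (Fm * (i : ℝ) ^ (2 * j + 1) / (π * (m : ℝ) ^ (2 * j + 2))
            - Fi * (i : ℝ) ^ (2 * j) / (π * (m : ℝ) ^ (2 * j + 1)))))
        - (-1 : ℝ) ^ ((i : ℤ) + m) * (16 / a * S2) * di * (dm - S) := by
    rw [h4, h3, h5, hsign]
    ring
  rw [e]
  have hkS' : 0 ≤ 16 / a * S2 := by positivity
  have hrem2 : |(-1 : ℝ) ^ ((i : ℤ) + m) * (16 / a * S2) * di * (dm - S)|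
      ≤ (16 / a * S2) * di * (a / (4 * π) * q ^ J / (m : ℝ) ^ (2 * J + 1)) := by
    rw [abs_mul, abs_mul, abs_mul, abs_neg_one_zpow_natCast_add', one_mul, abs_of_nonneg hkS', abs_of_pos hdi]
    exact mul_le_mul_of_nonneg_left hP (mul_nonneg hkS' hdi.le)
  refine (abs_sub _ _).trans ((add_le_add hK hrem2).trans (le_of_eq ?_))
  field_simp
  ring

end Decomp

/-! ## The order-`J` odd tail majorant -/

section Tail

set_option maxHeartbeats 400000 in
/-- **Odd tail majorant, order `J` (functional form).**  For `a > 0`, `1 ≤ B`, `2B ≤ B₃`, tail weights `0 < d₀ ≤ d_l`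
(`l ≥ B₃`, kernel index `l` = mode `l+1`), `θ, η > 0`, every `N` and every real block vector `x` (block row `k` = mode `k+1`). -/
theorem odd_tailJ_majorant (ha : 0 < a) {B B₃ : ℕ} (hB : 1 ≤ B) (hBB : 2 * B ≤ B₃) (J : ℕ)
    (d : ℕ → ℝ) {d₀ : ℝ} (hd₀ : 0 < d₀) (hd : ∀ l, B₃ ≤ l → d₀ ≤ d l) {θ η : ℝ} (hθ : 0 < θ) (hη : 0 < η)
    (N : ℕ) (x : Fin B → ℝ) :
    ∑ l ∈ Finset.Ico B₃ N, (∑ k : Fin B,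
        ((gramCoeff a (((k : ℕ) : ℤ) + 1) ((l : ℤ) + 1) - gramCoeff a (((k : ℕ) : ℤ) + 1) (-((l : ℤ) + 1))) / 2) * x k) ^ 2 / d l
      ≤ (1 + θ) * (1 + η) * ((π / 4 + (∑ k ∈ weilPrimeIndex a, (Λ k : ℝ) / Real.sqrt k) + a * (1 + weilArchDensity (2 * a)) / (π * ((B₃ : ℝ) + 1))) ^ 2 / (π ^ 2 * d₀))
          * ((∑ j : Fin J, ∑ j' : Fin J,
                (∑ k : Fin B, ((-1 : ℝ) ^ ((k : ℕ) + 1) * (((k : ℕ) : ℝ) + 1) ^ (2 * (j : ℕ) + 1)) * x k)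
                * (∑ k : Fin B, ((-1 : ℝ) ^ ((k : ℕ) + 1) * (((k : ℕ) : ℝ) + 1) ^ (2 * (j' : ℕ) + 1)) * x k)
                * ((1 / (((2 * (j : ℕ) + 2) + (2 * (j' : ℕ) + 2) - 1 : ℕ) * (B₃ : ℝ) ^ ((2 * (j : ℕ) + 2) + (2 * (j' : ℕ) + 2) - 1)) + 1 / (((2 * (j : ℕ) + 2) + (2 * (j' : ℕ) + 2) - 1 : ℕ) * ((B₃ + 1 : ℕ) : ℝ) ^ ((2 * (j : ℕ) + 2) + (2 * (j' : ℕ) + 2) - 1))) / 2))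
              + ∑ j : Fin J, (∑ k : Fin B, ((-1 : ℝ) ^ ((k : ℕ) + 1) * (((k : ℕ) : ℝ) + 1) ^ (2 * (j : ℕ) + 1)) * x k) ^ 2
                * ∑ j' : Fin J, ((1 / (((2 * (j : ℕ) + 2) + (2 * (j' : ℕ) + 2) - 1 : ℕ) * (B₃ : ℝ) ^ ((2 * (j : ℕ) + 2) + (2 * (j' : ℕ) + 2) - 1)) - 1 / (((2 * (j : ℕ) + 2) + (2 * (j' : ℕ) + 2) - 1 : ℕ) * ((B₃ + 1 : ℕ) : ℝ) ^ ((2 * (j : ℕ) + 2) + (2 * (j' : ℕ) + 2) - 1))) / 2) * (B : ℝ) ^ (2 * (j' : ℕ) + 2) / (B : ℝ) ^ (2 * (j : ℕ) + 2))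
        + (1 + θ) * (1 + η⁻¹) * (1 / d₀)
          * ((∑ r : Fin J, ∑ r' : Fin J,
                (∑ k : Fin B, ((-1 : ℝ) ^ ((k : ℕ) + 1) * (-((((k : ℕ) : ℝ) + 1) ^ (2 * (r : ℕ))) * ((Complex.digamma (1 / 4 + ((freq a (((k : ℕ) : ℤ) + 1) : ℝ) : ℂ) / 2 * I)).im / 2 + (∑ p ∈ weilPrimeIndex a, (Λ p : ℝ) / Real.sqrt p * Real.sin (freq a (((k : ℕ) : ℤ) + 1) * Real.log p)) - archExpSumSin a (((k : ℕ) : ℤ) + 1)) / π - 4 * (Real.exp (a / 2) - Real.exp (-(a / 2))) ^ 2 / π * (-1 : ℝ) ^ (r : ℕ) * (a ^ 2 / (4 * π ^ 2)) ^ (r : ℕ) * (freq a (((k : ℕ) : ℤ) + 1) / (1 + 4 * freq a (((k : ℕ) : ℤ) + 1) ^ 2)))) * x k)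
                * (∑ k : Fin B, ((-1 : ℝ) ^ ((k : ℕ) + 1) * (-((((k : ℕ) : ℝ) + 1) ^ (2 * (r' : ℕ))) * ((Complex.digamma (1 / 4 + ((freq a (((k : ℕ) : ℤ) + 1) : ℝ) : ℂ) / 2 * I)).im / 2 + (∑ p ∈ weilPrimeIndex a, (Λ p : ℝ) / Real.sqrt p * Real.sin (freq a (((k : ℕ) : ℤ) + 1) * Real.log p)) - archExpSumSin a (((k : ℕ) : ℤ) + 1)) / π - 4 * (Real.exp (a / 2) - Real.exp (-(a / 2))) ^ 2 / π * (-1 : ℝ) ^ (r' : ℕ) * (a ^ 2 / (4 * π ^ 2)) ^ (r' : ℕ) * (freq a (((k : ℕ) : ℤ) + 1) / (1 + 4 * freq a (((k : ℕ) : ℤ) + 1) ^ 2)))) * x k)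
                * ((1 / (((2 * (r : ℕ) + 1) + (2 * (r' : ℕ) + 1) - 1 : ℕ) * (B₃ : ℝ) ^ ((2 * (r : ℕ) + 1) + (2 * (r' : ℕ) + 1) - 1)) + 1 / (((2 * (r : ℕ) + 1) + (2 * (r' : ℕ) + 1) - 1 : ℕ) * ((B₃ + 1 : ℕ) : ℝ) ^ ((2 * (r : ℕ) + 1) + (2 * (r' : ℕ) + 1) - 1))) / 2))
              + ∑ r : Fin J, (∑ k : Fin B, ((-1 : ℝ) ^ ((k : ℕ) + 1) * (-((((k : ℕ) : ℝ) + 1) ^ (2 * (r : ℕ))) * ((Complex.digamma (1 / 4 + ((freq a (((k : ℕ) : ℤ) + 1) : ℝ) : ℂ) / 2 * I)).im / 2 + (∑ p ∈ weilPrimeIndex a, (Λ p : ℝ) / Real.sqrt p * Real.sin (freq a (((k : ℕ) : ℤ) + 1) * Real.log p)) - archExpSumSin a (((k : ℕ) : ℤ) + 1)) / π - 4 * (Real.exp (a / 2) - Real.exp (-(a / 2))) ^ 2 / π * (-1 : ℝ) ^ (r : ℕ) * (a ^ 2 / (4 * π ^ 2)) ^ (r : ℕ) * (freq a (((k : ℕ)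 : ℤ) + 1) / (1 + 4 * freq a (((k : ℕ) : ℤ) + 1) ^ 2)))) * x k) ^ 2
                * ∑ r' : Fin J, ((1 / (((2 * (r : ℕ) + 1) + (2 * (r' : ℕ) + 1) - 1 : ℕ) * (B₃ : ℝ) ^ ((2 * (r : ℕ) + 1) + (2 * (r' : ℕ) + 1) - 1)) - 1 / (((2 * (r : ℕ) + 1) + (2 * (r' : ℕ) + 1) - 1 : ℕ) * ((B₃ + 1 : ℕ) : ℝ) ^ ((2 * (r : ℕ) + 1) + (2 * (r' : ℕ) + 1) - 1))) / 2) * (B : ℝ) ^ (2 * (r' : ℕ) + 1) / (B : ℝ) ^ (2 * (r : ℕ) + 1))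
        + (1 + θ⁻¹) * ((B : ℝ) / (d₀ * ((4 * J + 1 : ℕ) * (B₃ : ℝ) ^ (4 * J + 1))))
          * ∑ k : Fin B, (2 * (π / 4 + (∑ k ∈ weilPrimeIndex a, (Λ k : ℝ) / Real.sqrt k) + a * (1 + weilArchDensity (2 * a)) / π) * (((k : ℕ) : ℝ) + 1) ^ (2 * J) / π + 4 * (Real.exp (a / 2) - Real.exp (-(a / 2))) ^ 2 / π * (a ^ 2 / (4 * π ^ 2)) ^ J * (freq a (((k : ℕ) : ℤ) + 1) / (1 + 4 * freq a (((k : ℕ) : ℤ) + 1) ^ 2))) ^ 2 * x k ^ 2 := by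
  -- abbreviations
  set T := Finset.Ico B₃ N with hT
  have hB₃2 : 2 ≤ B₃ := by omega
  have hB0 : (0 : ℝ) < B := by exact_mod_cast hB
  set CA : ℝ := π / 4 + (∑ k ∈ weilPrimeIndex a, (Λ k : ℝ) / Real.sqrt k)
      + a * (1 + weilArchDensity (2 * a)) / (π * ((B₃ : ℝ) + 1)) with hCA
  set Fmode : ℤ → ℝ := fun n ↦ (Complex.digamma (1 / 4 + ((freq a n : ℝ) : ℂ) / 2 * I)).im / 2
      + (∑ k ∈ weilPrimeIndex a, (Λ k : ℝ) / Real.sqrt k * Real.sin (freq a n * Real.log k)) - archExpSumSin a n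
    with hFmode
  set S2 : ℝ := (Real.exp (a / 2) - Real.exp (-(a / 2))) ^ 2 with hS2
  set q : ℝ := a ^ 2 / (4 * π ^ 2) with hq
  set dfac : ℤ → ℝ := fun n ↦ freq a n / (1 + 4 * freq a n ^ 2) with hdfac
  -- row functionals (row k = mode k+1)
  set vA : Fin J → Fin B → ℝ := fun j k ↦ (-1 : ℝ) ^ ((k : ℕ) + 1) * (((k : ℕ) : ℝ) + 1) ^ (2 * (j : ℕ) + 1) with hvA
  set vB : Fin J → Fin B → ℝ := fun r k ↦ (-1 : ℝ) ^ ((k : ℕ) + 1) *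
      (-((((k : ℕ) : ℝ) + 1) ^ (2 * (r : ℕ))) * Fmode (((k : ℕ) : ℤ) + 1) / π
        - 4 * S2 / π * (-1 : ℝ) ^ (r : ℕ) * q ^ (r : ℕ) * dfac (((k : ℕ) : ℤ) + 1)) with hvB
  set αA : Fin J → ℝ := fun j ↦ ∑ k, vA j k * x k with hαA
  set αB : Fin J → ℝ := fun r ↦ ∑ k, vB r k * x k with hαB
  set ρ : Fin B → ℝ := fun k ↦ (2 * (π / 4 + (∑ k ∈ weilPrimeIndex a, (Λ k : ℝ) / Real.sqrt k)
        + a * (1 + weilArchDensity (2 * a)) / π) * (((k : ℕ) : ℝ) + 1) ^ (2 * J) / π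
        + 4 * S2 / π * q ^ J * dfac (((k : ℕ) : ℤ) + 1)) with hρ
  set bcol : ℕ → Fin B → ℝ := fun l k ↦
    ((gramCoeff a (((k : ℕ) : ℤ) + 1) ((l : ℤ) + 1) - gramCoeff a (((k : ℕ) : ℤ) + 1) (-((l : ℤ) + 1))) / 2) with hbcol
  -- per-mode facts
  have hTl : ∀ l ∈ T, B₃ ≤ l := fun l hl ↦ (Finset.mem_Ico.mp hl).1
  have key : ∀ l ∈ T, (∑ k, bcol l k * x k) ^ 2 / d l
      ≤ (1 + θ) * (1 + η) * (CA ^ 2 / (π ^ 2 * d₀)) * (∑ j, αA j / ((l : ℝ) + 1) ^ (2 * (j : ℕ) + 2)) ^ 2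
        + (1 + θ) * (1 + η⁻¹) * (1 / d₀) * (∑ r, αB r / ((l : ℝ) + 1) ^ (2 * (r : ℕ) + 1)) ^ 2
        + (1 + θ⁻¹) * ((B : ℝ) / d₀) * (∑ k, ρ k ^ 2 * x k ^ 2) * (1 / (((l : ℝ) + 1) ^ (2 * J + 1)) ^ 2) := by
    intro l hl
    have hlB := hTl l hl
    have hl0 : (0 : ℝ) < (l : ℝ) + 1 := by positivity
    have hdl : d₀ ≤ d l := hd l hlB
    have hdpos : 0 < d l := lt_of_lt_of_le hd₀ hdl
    -- decomposition of the column sum (modes i = k+1, m = l+1)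
    set R : ℝ := ∑ k, (bcol l k - (-1 : ℝ) ^ (l + 1) *
        (Fmode ((l : ℤ) + 1) / π * ∑ j ∈ Finset.range J,
            ((-1 : ℝ) ^ ((k : ℕ) + 1) * (((k : ℕ) : ℝ) + 1) ^ (2 * j + 1)) / ((l : ℝ) + 1) ^ (2 * j + 2)
          + ∑ r ∈ Finset.range J, ((-1 : ℝ) ^ ((k : ℕ) + 1) *
              (-((((k : ℕ) : ℝ) + 1) ^ (2 * r)) * Fmode (((k : ℕ) : ℤ) + 1) / π
                - 4 * S2 / π * (-1 : ℝ) ^ r * q ^ r * dfac (((k : ℕ) : ℤ) + 1))) / ((l : ℝ) + 1) ^ (2 * r + 1)))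
        * x k with hR
    have hsplit : ∑ k, bcol l k * x k = (-1 : ℝ) ^ (l + 1) *
        (Fmode ((l : ℤ) + 1) / π * (∑ j, αA j / ((l : ℝ) + 1) ^ (2 * (j : ℕ) + 2))
          + (∑ r, αB r / ((l : ℝ) + 1) ^ (2 * (r : ℕ) + 1))) + R := by
      have ePA : (∑ j, αA j / ((l : ℝ) + 1) ^ (2 * (j : ℕ) + 2)) = ∑ k : Fin B, (∑ j ∈ Finset.range J,
          ((-1 : ℝ) ^ ((k : ℕ) + 1) * (((k : ℕ) : ℝ) + 1) ^ (2 * j + 1)) / ((l : ℝ) + 1) ^ (2 * j + 2)) * x k := by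
        simp only [hαA, hvA, Finset.sum_div]
        rw [Finset.sum_comm]
        refine Finset.sum_congr rfl fun k _ ↦ ?_
        rw [Finset.sum_mul, Finset.sum_range]
        refine Finset.sum_congr rfl fun j _ ↦ by ring
      have ePB : (∑ r, αB r / ((l : ℝ) + 1) ^ (2 * (r : ℕ) + 1)) = ∑ k : Fin B, (∑ r ∈ Finset.range J,
          ((-1 : ℝ) ^ ((k : ℕ) + 1) *
            (-((((k : ℕ) : ℝ) + 1) ^ (2 * r)) * Fmode (((k : ℕ) : ℤ) + 1) / π
              - 4 * S2 / π * (-1 : ℝ) ^ r * q ^ r * dfac (((k : ℕ) : ℤ) + 1))) / ((l : ℝ) + 1) ^ (2 * r + 1)) * x k := by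
        simp only [hαB, hvB, Finset.sum_div]
        rw [Finset.sum_comm]
        refine Finset.sum_congr rfl fun k _ ↦ ?_
        rw [Finset.sum_mul, Finset.sum_range]
        refine Finset.sum_congr rfl fun r _ ↦ by ring
      rw [ePA, ePB, hR, Finset.mul_sum, mul_add, Finset.mul_sum, Finset.mul_sum, ← Finset.sum_add_distrib,
        ← Finset.sum_add_distrib]
      refine Finset.sum_congr rfl fun k _ ↦ by ring
    -- the remainder bound per row, via the mode-level decomposition lemma
    have hrow : ∀ k : Fin B, abs (bcol l k - (-1 : ℝ) ^ (l + 1) *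
        (Fmode ((l : ℤ) + 1) / π * ∑ j ∈ Finset.range J,
            ((-1 : ℝ) ^ ((k : ℕ) + 1) * (((k : ℕ) : ℝ) + 1) ^ (2 * j + 1)) / ((l : ℝ) + 1) ^ (2 * j + 2)
          + ∑ r ∈ Finset.range J, ((-1 : ℝ) ^ ((k : ℕ) + 1) *
              (-((((k : ℕ) : ℝ) + 1) ^ (2 * r)) * Fmode (((k : ℕ) : ℤ) + 1) / π
                - 4 * S2 / π * (-1 : ℝ) ^ r * q ^ r * dfac (((k : ℕ) : ℤ) + 1))) / ((l : ℝ) + 1) ^ (2 * r + 1)))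
        ≤ ρ k / ((l : ℝ) + 1) ^ (2 * J + 1) := by
      intro k
      have him : 2 * ((k : ℕ) + 1) ≤ l + 1 := by have := k.isLt; omega
      have h := abs_oddKernel_col_sub_families_le ha (i := (k : ℕ) + 1) (m := l + 1) (by omega) him J
      simp only [hbcol, hFmode, hS2, hq, hdfac, hρ]
      push_cast at h ⊢
      exact h
    have hRsq : R ^ 2 ≤ (B : ℝ) * (∑ k, ρ k ^ 2 * x k ^ 2) * (1 / (((l : ℝ) + 1) ^ (2 * J + 1)) ^ 2) := by
      have h := sq_sum_mul_le_card_mul (ι := Fin B) _ (fun k ↦ ρ k / ((l : ℝ) + 1) ^ (2 * J + 1)) x hrow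
      simp only [Fintype.card_fin] at h
      refine h.trans (le_of_eq ?_)
      rw [mul_assoc, Finset.sum_mul]
      congr 1
      refine Finset.sum_congr rfl fun k _ ↦ ?_
      rw [div_pow]
      ring
    -- the structured part
    have hFm : |Fmode ((l : ℤ) + 1)| ≤ CA := by
      have h := abs_modeF_le_far ha (B₃ := B₃ + 1) (m := l + 1) (by omega) (by omega)
      simp only [hFmode, hCA]
      push_cast at h ⊢
      exact h
    have hmain : (Fmode ((l : ℤ) + 1) / π * (∑ j, αA j / ((l : ℝ) + 1) ^ (2 * (j : ℕ) + 2))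
          + (∑ r, αB r / ((l : ℝ) + 1) ^ (2 * (r : ℕ) + 1))) ^ 2
        ≤ (1 + η) * (CA ^ 2 / π ^ 2) * (∑ j, αA j / ((l : ℝ) + 1) ^ (2 * (j : ℕ) + 2)) ^ 2
          + (1 + η⁻¹) * (∑ r, αB r / ((l : ℝ) + 1) ^ (2 * (r : ℕ) + 1)) ^ 2 := by
      have hpp := sq_add_le_peterPaul (p := Fmode ((l : ℤ) + 1) / π * (∑ j, αA j / ((l : ℝ) + 1) ^ (2 * (j : ℕ) + 2)))
        (q := (∑ r, αB r / ((l : ℝ) + 1) ^ (2 * (r : ℕ) + 1))) hη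
      have hF2 : (Fmode ((l : ℤ) + 1) / π * (∑ j, αA j / ((l : ℝ) + 1) ^ (2 * (j : ℕ) + 2))) ^ 2
          ≤ CA ^ 2 / π ^ 2 * (∑ j, αA j / ((l : ℝ) + 1) ^ (2 * (j : ℕ) + 2)) ^ 2 := by
        rw [mul_pow, div_pow]
        refine mul_le_mul_of_nonneg_right ?_ (sq_nonneg _)
        refine div_le_div_of_nonneg_right ?_ (by positivity)
        calc Fmode ((l : ℤ) + 1) ^ 2 = |Fmode ((l : ℤ) + 1)| ^ 2 := (sq_abs _).symm
          _ ≤ CA ^ 2 := pow_le_pow_left₀ (abs_nonneg _) hFm 2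
      have h1 : 0 ≤ 1 + η := by positivity
      refine hpp.trans ((add_le_add (mul_le_mul_of_nonneg_left hF2 h1) le_rfl).trans (le_of_eq ?_))
      ring
    have hsq : (∑ k, bcol l k * x k) ^ 2
        ≤ (1 + θ) * ((1 + η) * (CA ^ 2 / π ^ 2) * (∑ j, αA j / ((l : ℝ) + 1) ^ (2 * (j : ℕ) + 2)) ^ 2
            + (1 + η⁻¹) * (∑ r, αB r / ((l : ℝ) + 1) ^ (2 * (r : ℕ) + 1)) ^ 2)
          + (1 + θ⁻¹) * ((B : ℝ) * (∑ k, ρ k ^ 2 * x k ^ 2) * (1 / (((l : ℝ) + 1) ^ (2 * J + 1)) ^ 2)) := by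
      rw [hsplit]
      have hpp := sq_add_le_peterPaul (p := (-1 : ℝ) ^ (l + 1) *
        (Fmode ((l : ℤ) + 1) / π * (∑ j, αA j / ((l : ℝ) + 1) ^ (2 * (j : ℕ) + 2))
          + (∑ r, αB r / ((l : ℝ) + 1) ^ (2 * (r : ℕ) + 1)))) (q := R) hθ
      have hsgn : ((-1 : ℝ) ^ (l + 1) *
          (Fmode ((l : ℤ) + 1) / π * (∑ j, αA j / ((l : ℝ) + 1) ^ (2 * (j : ℕ) + 2))
            + (∑ r, αB r / ((l : ℝ) + 1) ^ (2 * (r : ℕ) + 1)))) ^ 2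
          = (Fmode ((l : ℤ) + 1) / π * (∑ j, αA j / ((l : ℝ) + 1) ^ (2 * (j : ℕ) + 2))
            + (∑ r, αB r / ((l : ℝ) + 1) ^ (2 * (r : ℕ) + 1))) ^ 2 := by
        rw [mul_pow, ← pow_mul, Even.neg_one_pow (by exact ⟨l + 1, by ring⟩), one_mul]
      rw [hsgn] at hpp
      have h1 : 0 ≤ 1 + θ := by positivity
      have h2 : 0 ≤ 1 + θ⁻¹ := by positivity
      exact hpp.trans (add_le_add (mul_le_mul_of_nonneg_left hmain h1) (mul_le_mul_of_nonneg_left hRsq h2))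
    have hnn : 0 ≤ (1 + θ) * ((1 + η) * (CA ^ 2 / π ^ 2) * (∑ j, αA j / ((l : ℝ) + 1) ^ (2 * (j : ℕ) + 2)) ^ 2
            + (1 + η⁻¹) * (∑ r, αB r / ((l : ℝ) + 1) ^ (2 * (r : ℕ) + 1)) ^ 2)
          + (1 + θ⁻¹) * ((B : ℝ) * (∑ k, ρ k ^ 2 * x k ^ 2) * (1 / (((l : ℝ) + 1) ^ (2 * J + 1)) ^ 2)) := by
      have : 0 ≤ ∑ k, ρ k ^ 2 * x k ^ 2 := Finset.sum_nonneg fun k _ ↦ by positivity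
      positivity
    calc (∑ k, bcol l k * x k) ^ 2 / d l
        ≤ _ := div_le_div_of_nonneg_right hsq hdpos.le
      _ ≤ ((1 + θ) * ((1 + η) * (CA ^ 2 / π ^ 2) * (∑ j, αA j / ((l : ℝ) + 1) ^ (2 * (j : ℕ) + 2)) ^ 2
            + (1 + η⁻¹) * (∑ r, αB r / ((l : ℝ) + 1) ^ (2 * (r : ℕ) + 1)) ^ 2)
          + (1 + θ⁻¹) * ((B : ℝ) * (∑ k, ρ k ^ 2 * x k ^ 2) * (1 / (((l : ℝ) + 1) ^ (2 * J + 1)) ^ 2))) / d₀ :=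
          div_le_div_of_nonneg_left hnn hd₀ hdl
      _ = _ := by
          field_simp
  -- sum over the tail (reindex l + 1 = m ∈ Ico (B₃+1) (N+1)) and apply the Hankel bounds
  have hsumA0 := sum_Ico_sq_sum_div_pow_le (D := J) (fun j ↦ 2 * (j : ℕ) + 2) (fun j ↦ by omega) (by omega : 2 ≤ B₃ + 1)
    (fun j ↦ (B : ℝ) ^ (2 * (j : ℕ) + 2)) (fun j ↦ by positivity) (N + 1) αA
  have hsumB0 := sum_Ico_sq_sum_div_pow_le (D := J) (fun r ↦ 2 * (r : ℕ) + 1) (fun r ↦ by omega) (by omega : 2 ≤ B₃ + 1)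
    (fun r ↦ (B : ℝ) ^ (2 * (r : ℕ) + 1)) (fun r ↦ by positivity) (N + 1) αB
  have hsumR0 := sum_Ico_one_div_pow_two_mul_le (E := 2 * J + 1) (by omega) (by omega : 2 ≤ B₃ + 1) (N + 1)
  have h4J : 2 * (2 * J + 1) - 1 = 4 * J + 1 := by omega
  rw [h4J] at hsumR0
  simp only [Nat.add_sub_cancel] at hsumA0 hsumB0 hsumR0
  have hreA : ∑ l ∈ T, (∑ j, αA j / ((l : ℝ) + 1) ^ (2 * (j : ℕ) + 2)) ^ 2
      = ∑ m ∈ Finset.Ico (B₃ + 1) (N + 1), (∑ j, αA j / (m : ℝ) ^ (2 * (j : ℕ) + 2)) ^ 2 := by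
    rw [hT, ← Finset.sum_Ico_add' (c := 1)]
    refine Finset.sum_congr rfl fun l _ ↦ ?_
    push_cast
    ring
  have hreB : ∑ l ∈ T, (∑ r, αB r / ((l : ℝ) + 1) ^ (2 * (r : ℕ) + 1)) ^ 2
      = ∑ m ∈ Finset.Ico (B₃ + 1) (N + 1), (∑ r, αB r / (m : ℝ) ^ (2 * (r : ℕ) + 1)) ^ 2 := by
    rw [hT, ← Finset.sum_Ico_add' (c := 1)]
    refine Finset.sum_congr rfl fun l _ ↦ ?_
    push_cast
    ring
  have hreR : ∑ l ∈ T, 1 / (((l : ℝ) + 1) ^ (2 * J + 1)) ^ 2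
      = ∑ m ∈ Finset.Ico (B₃ + 1) (N + 1), 1 / ((m : ℝ) ^ (2 * J + 1)) ^ 2 := by
    rw [hT, ← Finset.sum_Ico_add' (c := 1)]
    refine Finset.sum_congr rfl fun l _ ↦ ?_
    push_cast
    ring
  have hsumA := (le_of_eq hreA).trans hsumA0
  have hsumB := (le_of_eq hreB).trans hsumB0
  have hR' : ∑ l ∈ T, 1 / (((l : ℝ) + 1) ^ (2 * J + 1)) ^ 2 ≤ 1 / ((4 * J + 1 : ℕ) * (B₃ : ℝ) ^ (4 * J + 1)) :=
    (le_of_eq hreR).trans hsumR0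
  -- the three coefficient signs
  have hcA : 0 ≤ (1 + θ) * (1 + η) * (CA ^ 2 / (π ^ 2 * d₀)) := by positivity
  have hcB : 0 ≤ (1 + θ) * (1 + η⁻¹) * (1 / d₀) := by positivity
  have hcR : 0 ≤ (1 + θ⁻¹) * ((B : ℝ) / d₀) * (∑ k, ρ k ^ 2 * x k ^ 2) := by
    have : 0 ≤ ∑ k, ρ k ^ 2 * x k ^ 2 := Finset.sum_nonneg fun k _ ↦ by positivity
    positivity
  have step1 : ∑ l ∈ T, (∑ k, bcol l k * x k) ^ 2 / d l
      ≤ (1 + θ) * (1 + η) * (CA ^ 2 / (π ^ 2 * d₀)) * ∑ l ∈ T, (∑ j, αA j / ((l : ℝ) + 1) ^ (2 * (j : ℕ) + 2)) ^ 2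
          + (1 + θ) * (1 + η⁻¹) * (1 / d₀) * ∑ l ∈ T, (∑ r, αB r / ((l : ℝ) + 1) ^ (2 * (r : ℕ) + 1)) ^ 2
          + (1 + θ⁻¹) * ((B : ℝ) / d₀) * (∑ k, ρ k ^ 2 * x k ^ 2) * ∑ l ∈ T, (1 / (((l : ℝ) + 1) ^ (2 * J + 1)) ^ 2) := by
    refine (Finset.sum_le_sum key).trans (le_of_eq ?_)
    simp only [Finset.sum_add_distrib, ← Finset.mul_sum]
  have step2 := add_le_add (add_le_add (mul_le_mul_of_nonneg_left hsumA hcA) (mul_le_mul_of_nonneg_left hsumB hcB))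
    (mul_le_mul_of_nonneg_left hR' hcR)
  refine (step1.trans step2).trans (le_of_eq ?_)
  simp only [hαA, hαB, hvA, hvB, hρ, hCA, hFmode, hS2, hq, hdfac]
  ring

end Tail

end Summit.RiemannHypothesis.RiemannHypothesis.Theorems.WeilFormatC

end
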